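import Mathlib
import HarnessLib

/-!
# Route `PoloidalWindowDoor`, crux `PoloidalWindowRigidity` (K2, stmt-NavierStokesRegularity-19708) — a brick for H5
# (`divFormLiouville_holds`, ns-poloidal-K2-p3's De Giorgi–Nash–Moser programme): LIOUVILLE FROM A GLOBAL HARNACK
# INEQUALITY, abstractly

Cell ns-regularity-ideate, seat nsreg-p7 gen 5 (third worker; file landed `--supports stmt-NavierStokesRegularity-19708`
as a helper).  The last step of Moser's route to the Liouville theorem for `div(a∇u) = 0` (Moser 1961, the corollary of
Thm 1; Jost, PDE, Thm 14.2.3) uses nothing about the equation except two facts: the solution class is invariant under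
adding constants, and POSITIVE entire solutions satisfy a GLOBAL Harnack inequality `w(x) ≤ C_H w(y)` for all `x, y`
(the scale-invariant Harnack inequality on `B_R ⊂ B_{2R}` with `R → ∞`).  This file isolates that step so that the H5
chain (p484360 Caccioppoli → p484929 powers → log-BMO → John–Nirenberg → Moser iteration → Harnack) can end with a
one-line call:

* `liouville_of_globalHarnack` — for ANY predicate `P` on real functions on any type, closed under `u ↦ u + c`, such
  that every `P`-function with positive values satisfies `w x ≤ C · w y` for all `x, y`: every `P`-function that is
  bounded BELOW is constant (`u − inf u + ε` is a positive `P`-function; Harnack at a near-infimum point gives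
  `u x − inf u ≤ (C − 1)ε + Cδ`);
* `liouville_of_globalHarnack_of_bddAbove` — the mirror statement for functions bounded above when `P` is also closed
  under negation;
* `liouville_of_globalHarnack_abs` — the two-sided corollary in the shape of `Literature.Analysis.PDE.divFormLiouville`
  (`∃ K, ∀ y, |u y| ≤ K`).

WHAT THIS IS NOT: not a claim about Navier–Stokes and not the Harnack inequality — an order-theoretic lemma
(bears_on LADDER-NS N0 via M11/H5 of crux K2; [folklore], Moser 1961 corollary).
-/

noncomputable section

-- the summit and its single sub-problem share the name (CONVENTIONS §1), as in every Theorems file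
set_option linter.dupNamespace false

namespace Summit.NavierStokesRegularity.NavierStokesRegularity.Theorems.PoloidalWindowDoorPoloidalWindowRigidityHarnackToLiouville

open Set

variable {α : Type*}

/-- **Liouville from a global Harnack inequality (one-sided bound).**  Let `P` be a property of real functions on
`α`, invariant under adding constants, such that every `P`-function with (strictly) positive values satisfies the
global Harnack inequality `w x ≤ C * w y` for all `x, y`.  Then every `P`-function bounded below is constant.
[folklore] (the Liouville corollary of Moser 1961, Thm 1; Jost, PDE, Thm 14.2.3.) -/
theorem liouville_of_globalHarnack {P : (α → ℝ) → Prop} {C : ℝ}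
    (hadd : ∀ (u : α → ℝ) (c : ℝ), P u → P (fun x => u x + c))
    (harnack : ∀ w : α → ℝ, P w → (∀ x, 0 < w x) → ∀ x y, w x ≤ C * w y)
    {u : α → ℝ} (hu : P u) (hbdd : BddBelow (range u)) : ∀ x y, u x = u y := by
  classical
  rcases isEmpty_or_nonempty α with hα | hα
  · intro x; exact (IsEmpty.false x).elim
  set m : ℝ := sInf (range u) with hm
  have hm_le : ∀ x, m ≤ u x := fun x => csInf_le hbdd (mem_range_self x)
  -- every value equals the infimum
  have key : ∀ x, u x ≤ m := by
    intro x
    refine le_of_forall_pos_lt_add fun η hη => ?_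
    -- the positive `P`-function `w = u − m + ε`
    -- first get `1 ≤ C` from Harnack applied to `w` at `x, x`
    set ε : ℝ := 1 with hε
    set w : α → ℝ := fun z => u z + (ε - m) with hw
    have hwP : P w := hadd u (ε - m) hu
    have hwpos : ∀ z, 0 < w z := fun z => by simp only [hw]; linarith [hm_le z]
    have hC1 : 1 ≤ C := by
      have h := harnack w hwP hwpos x x
      have hx : 0 < w x := hwpos x
      by_contra hC
      push Not at hC
      nlinarith
    -- now with a small `ε'` and a near-infimum point `y`
    obtain ⟨ε', hε'pos, hε'⟩ : ∃ ε' : ℝ, 0 < ε' ∧ (2 * C - 1) * ε' < η :=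
      ⟨η / (2 * C), by positivity, by
        rw [show (2 * C - 1) * (η / (2 * C)) = η - η / (2 * C) by field_simp]
        linarith [div_pos hη (by positivity : (0 : ℝ) < 2 * C)]⟩
    obtain ⟨y, hy⟩ : ∃ y, u y < m + ε' := by
      have h : sInf (range u) < m + ε' := by rw [hm]; linarith
      obtain ⟨_, ⟨y, rfl⟩, hy⟩ := exists_lt_of_csInf_lt (range_nonempty u) h
      exact ⟨y, hy⟩
    set w' : α → ℝ := fun z => u z + (ε' - m) with hw'
    have hw'P : P w' := hadd u (ε' - m) hu
    have hw'pos : ∀ z, 0 < w' z := fun z => by simp only [hw']; linarith [hm_le z]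
    have h := harnack w' hw'P hw'pos x y
    simp only [hw'] at h
    -- `u x − m + ε' ≤ C (u y − m + ε') < C · 2ε'`
    have h2 : u y + (ε' - m) < 2 * ε' := by linarith
    have h3 : C * (u y + (ε' - m)) ≤ C * (2 * ε') :=
      mul_le_mul_of_nonneg_left h2.le (by linarith)
    linarith
  intro x y
  exact le_antisymm ((key x).trans (hm_le y)) ((key y).trans (hm_le x))

/-- Mirror form: if `P` is moreover closed under negation, every `P`-function bounded ABOVE is constant. [folklore] -/
theorem liouville_of_globalHarnack_of_bddAbove {P : (α → ℝ) → Prop} {C : ℝ}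
    (hadd : ∀ (u : α → ℝ) (c : ℝ), P u → P (fun x => u x + c))
    (hneg : ∀ u : α → ℝ, P u → P (fun x => -u x))
    (harnack : ∀ w : α → ℝ, P w → (∀ x, 0 < w x) → ∀ x y, w x ≤ C * w y)
    {u : α → ℝ} (hu : P u) (hbdd : BddAbove (range u)) : ∀ x y, u x = u y := by
  have hb : BddBelow (range fun x => -u x) := by
    obtain ⟨B, hB⟩ := hbdd
    refine ⟨-B, ?_⟩
    rintro _ ⟨x, rfl⟩
    exact neg_le_neg (hB (mem_range_self x))
  have h := liouville_of_globalHarnack hadd harnack (hneg u hu) hb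
  intro x y
  have := h x y
  linarith

/-- Two-sided form, in the shape used by `Literature.Analysis.PDE.divFormLiouville` (`∃ K, ∀ y, |u y| ≤ K`).
[folklore] -/
theorem liouville_of_globalHarnack_abs {P : (α → ℝ) → Prop} {C : ℝ}
    (hadd : ∀ (u : α → ℝ) (c : ℝ), P u → P (fun x => u x + c))
    (harnack : ∀ w : α → ℝ, P w → (∀ x, 0 < w x) → ∀ x y, w x ≤ C * w y)
    {u : α → ℝ} (hu : P u) (hbdd : ∃ K : ℝ, ∀ y, |u y| ≤ K) : ∀ x y, u x = u y := by
  obtain ⟨K, hK⟩ := hbdd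
  refine liouville_of_globalHarnack hadd harnack hu ⟨-K, ?_⟩
  rintro _ ⟨x, rfl⟩
  exact (abs_le.1 (hK x)).1

end Summit.NavierStokesRegularity.NavierStokesRegularity.Theorems.PoloidalWindowDoorPoloidalWindowRigidityHarnackToLiouville

end
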